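import Mathlib.Algebra.Group.Subgroup.Defs
import Mathlib.Analysis.SpecialFunctions.Pow.Real
import Mathlib.Tactic.Group
import Mathlib.Tactic.Ring
import Literature.Combinatorics.Additive.TripleProductProperty
import Literature.Combinatorics.Additive.TPPGroupAlgebra
import HarnessLib

/-!
# BCGPU 2023, Remark 3.7: the normaliser barrier for TPP triples of SUBSETS —
`|S||T||U| ≤ (|G|³ / (|N(Q(S)) ∩ T| |N(Q(T)) ∩ U| |N(Q(U)) ∩ S|))^{1/2}`

Topic `Literature/Barriers/MatrixMultiplication`; companion of `NormalizerBarrier.lean`, which proves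
Thm. 3.6 / Cor. 3.8 of the same paper for three SUBGROUPS and lists the present remark as "not
formalised here" in its `scope_caveats` (a), (d).  Everything in this file is PROVED (0 definitions,
0 named facts); the TPP is the tree's right-quotient `Literature.Combinatorics.Additive.TripleProductProperty`
(`s s'⁻¹ · t t'⁻¹ · u u'⁻¹ = 1 ⇒ s = s', t = t', u = u'`), `Q(X) = {x x'⁻¹ : x, x' ∈ X}` is its
right quotient set and `N(X) = {g : g X g⁻¹ = X}` is Mathlib's `Subgroup.normalizer (X : Set G)`.

J. Blasiak, H. Cohn, J. A. Grochow, K. Pratt, C. Umans, *Matrix multiplication via matrix groups*,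
ITCS 2023 (arXiv:2204.03826), p. 7 of the held text, verbatim:

> For `X ⊆ G`, let `N(X) = {g ∈ G : gXg⁻¹ = X}` denote the normalizer of `X` in `G` […]
> **Theorem 3.6.** […] *Proof.* The main observation in this proof is that
> `|H₁| |N(H₁) ∩ H₂| |H₃| ≤ |G|` (and the analogous inequality for any permutation of `H₁`, `H₂`, and
> `H₃`). To prove this inequality, we will show that the map `(h₁,h₂,h₃) ↦ h₁h₂h₃` is injective on
> `H₁ × (N(H₁) ∩ H₂) × H₃`. […]
> **Remark 3.7.** The same proof in fact works for subsets `S,T,U` satisfying the triple product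
> property, not just subgroups, and leads to the conclusion that
> `|S| |T| |U| ≤ ( |G|³ / (|N(Q(S)) ∩ T| |N(Q(T)) ∩ U| |N(Q(U)) ∩ S|) )^{1/2}`.

How "the same proof" is run here (recorded deviation, cf. `NormalizerBarrier.lean` scope_caveats (d)):
with right quotients the injective map is `(s, t, u) ↦ s⁻¹ t u` on `S × (N(Q(U)) ∩ T) × U` — an equality
`s⁻¹tu = s'⁻¹t'u'` gives `(s's⁻¹) · t(uu'⁻¹)t⁻¹ · (tt'⁻¹) = 1` with the middle factor in `Q(U)` because
`t ∈ N(Q(U))`, a TPP relation for the TRANSPOSED triple `(S, U, T)`; the right-quotient TPP is invariant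
under all permutations of the three sets (`TripleProductProperty.rotate` in the tree, `.reverse`,
`.swap₁₂`, `.swap₂₃` here), so this yields `|S| |N(Q(U)) ∩ T| |U| ≤ |G|` for every TPP triple and, applied
to the permuted triples `(U,T,S)`, `(S,U,T)`, `(T,S,U)`, the three printed factors.

## What is here
* `TripleProductProperty.reverse` / `.swap₁₂` / `.swap₂₃` — permutation invariance of the
  right-quotient TPP (CU03 §2);
* `tpp_card_mul_card_normalizer_quot_mul_card_le` — the main observation for subsets:
  `|S| · |N(Q(U)) ∩ T| · |U| ≤ |G|`;
* `BCGPU2023_rem37_sq` — **Remark 3.7, integral form**: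
  `(|S||T||U|)² · |N(Q(S)) ∩ T| · |N(Q(T)) ∩ U| · |N(Q(U)) ∩ S| ≤ |G|³`;
* `BCGPU2023_rem37` — **Remark 3.7 as printed** (real form with the square root), under the
  non-vacuity hypotheses that the three intersections are non-empty (for an empty intersection the
  printed right-hand side is `+∞` and the integral form is the whole content).

## References
* [BlasiakCohnGrochowPrattUmans2023] Thm. 3.6 (proof) and Rem. 3.7, p. 7.
* [CohnUmans2003] Def. 2.1 and §2 (permutations of a TPP triple).
-/

noncomputable section

open Finset

namespace Literature.Combinatorics.Additive

variable {G : Type*} [Group G]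

/-- The right-quotient TPP is invariant under reversing the triple: `(S, T, U) ↦ (U, T, S)` (invert
the word `q₁q₂q₃ = 1` and use `Q(X)⁻¹ = Q(X)`). [cite: CohnUmans2003, Def. 2.1] -/
theorem TripleProductProperty.reverse {S T U : Finset G} (h : TripleProductProperty S T U) :
    TripleProductProperty U T S := by
  intro u hu u' hu' t ht t' ht' s hs s' hs' heq
  have heq' : s' * s⁻¹ * (t' * t⁻¹) * (u' * u⁻¹) = 1 := by
    have := congrArg (·⁻¹) heq
    simpa only [mul_inv_rev, inv_inv, inv_one, mul_assoc] using this
  obtain ⟨h1, h2, h3⟩ := h s' hs' s hs t' ht' t ht u' hu' u hu heq'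
  exact ⟨h3.symm, h2.symm, h1.symm⟩

/-- Transposing the first two sets: `(S, T, U) ↦ (T, S, U)`. [cite: CohnUmans2003, Def. 2.1] -/
theorem TripleProductProperty.swap₁₂ {S T U : Finset G} (h : TripleProductProperty S T U) :
    TripleProductProperty T S U :=
  h.reverse.rotate

/-- Transposing the last two sets: `(S, T, U) ↦ (S, U, T)`. [cite: CohnUmans2003, Def. 2.1] -/
theorem TripleProductProperty.swap₂₃ {S T U : Finset G} (h : TripleProductProperty S T U) :
    TripleProductProperty S U T :=
  h.reverse.rotate.rotate

end Literature.Combinatorics.Additive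

namespace Literature.Barriers.MatrixMultiplication

open Literature.Combinatorics.Additive

universe u

variable {G : Type u} [Group G]

/-- **BCGPU 2023, the main observation of Thm. 3.6 for SUBSETS (Rem. 3.7)**: for a TPP triple
`(S, T, U)` of subsets of a finite group, `(s, t, u) ↦ s⁻¹ t u` is injective on
`S × (N(Q(U)) ∩ T) × U`, hence `|S| · |N(Q(U)) ∩ T| · |U| ≤ |G|`, where
`Q(U) = {u u'⁻¹ : u, u' ∈ U}` and `N(X) = {g : gXg⁻¹ = X}` (`Subgroup.normalizer (X : Set G)`).
[cite: BlasiakCohnGrochowPrattUmans2023, Rem. 3.7 (with Thm. 3.6, proof)] -/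
theorem tpp_card_mul_card_normalizer_quot_mul_card_le [Fintype G] [DecidableEq G] {S T U : Finset G}
    (h : TripleProductProperty S T U)
    [DecidablePred (· ∈ Subgroup.normalizer {g : G | ∃ u ∈ U, ∃ u' ∈ U, u * u'⁻¹ = g})] :
    S.card * (T.filter (· ∈ Subgroup.normalizer {g : G | ∃ u ∈ U, ∃ u' ∈ U, u * u'⁻¹ = g})).card *
      U.card ≤ Fintype.card G := by
  have h' := h.swap₂₃
  rw [← Finset.card_product, ← Finset.card_product, ← Finset.card_univ]
  refine Finset.card_le_card_of_injOn (fun x => x.1.1⁻¹ * x.1.2 * x.2) (fun _ _ => Finset.mem_univ _) ?_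
  rintro ⟨⟨s, t⟩, u⟩ hx ⟨⟨s', t'⟩, u'⟩ hx' he
  simp only [Finset.coe_product, Finset.coe_filter, Set.mem_prod, Finset.mem_coe, Set.mem_setOf_eq]
    at hx hx'
  obtain ⟨⟨hs, ht, htN⟩, hu⟩ := hx
  obtain ⟨⟨hs', ht', -⟩, hu'⟩ := hx'
  simp only at he
  -- `t (u u'⁻¹) t⁻¹ ∈ Q(U)` since `t ∈ N(Q(U))`
  obtain ⟨u₁, hu₁, u₂, hu₂, hq⟩ :=
    (Subgroup.mem_set_normalizer_iff.1 htN (u * u'⁻¹)).1 ⟨u, hu, u', hu', rfl⟩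
  -- the TPP word for the transposed triple `(S, U, T)`
  have hword : s' * s⁻¹ * (u₁ * u₂⁻¹) * (t * t'⁻¹) = 1 := by
    rw [hq]
    calc s' * s⁻¹ * (t * (u * u'⁻¹) * t⁻¹) * (t * t'⁻¹)
        = s' * (s⁻¹ * t * u) * u'⁻¹ * t'⁻¹ := by group
      _ = s' * (s'⁻¹ * t' * u') * u'⁻¹ * t'⁻¹ := by rw [he]
      _ = 1 := by group
  obtain ⟨e1, -, e3⟩ := h' s' hs' s hs u₁ hu₁ u₂ hu₂ t ht t' ht' hword
  subst e1
  subst e3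
  have hu_eq : u = u' := mul_left_cancel he
  subst hu_eq
  rfl

/-- **BCGPU 2023, Remark 3.7, integral form**: for every TPP triple `(S, T, U)` of subsets of a finite
group, `(|S||T||U|)² · |N(Q(S)) ∩ T| · |N(Q(T)) ∩ U| · |N(Q(U)) ∩ S| ≤ |G|³` (the main observation
applied to the permuted triples `(U,T,S)`, `(S,U,T)`, `(T,S,U)` and multiplied).
[cite: BlasiakCohnGrochowPrattUmans2023, Rem. 3.7] -/
theorem BCGPU2023_rem37_sq [Fintype G] [DecidableEq G] {S T U : Finset G} (h : TripleProductProperty S T U)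
    [DecidablePred (· ∈ Subgroup.normalizer {g : G | ∃ x ∈ S, ∃ x' ∈ S, x * x'⁻¹ = g})]
    [DecidablePred (· ∈ Subgroup.normalizer {g : G | ∃ x ∈ T, ∃ x' ∈ T, x * x'⁻¹ = g})]
    [DecidablePred (· ∈ Subgroup.normalizer {g : G | ∃ x ∈ U, ∃ x' ∈ U, x * x'⁻¹ = g})] :
    (S.card * T.card * U.card) ^ 2 *
      ((T.filter (· ∈ Subgroup.normalizer {g : G | ∃ x ∈ S, ∃ x' ∈ S, x * x'⁻¹ = g})).card *
        (U.filter (· ∈ Subgroup.normalizer {g : G | ∃ x ∈ T, ∃ x' ∈ T, x * x'⁻¹ = g})).card *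
        (S.filter (· ∈ Subgroup.normalizer {g : G | ∃ x ∈ U, ∃ x' ∈ U, x * x'⁻¹ = g})).card) ≤
      Fintype.card G ^ 3 := by
  -- (U,T,S): |U| |N(Q(S)) ∩ T| |S| ≤ |G|
  have e1 := tpp_card_mul_card_normalizer_quot_mul_card_le h.reverse
  -- (S,U,T): |S| |N(Q(T)) ∩ U| |T| ≤ |G|
  have e2 := tpp_card_mul_card_normalizer_quot_mul_card_le h.swap₂₃
  -- (T,S,U): |T| |N(Q(U)) ∩ S| |U| ≤ |G|
  have e3 := tpp_card_mul_card_normalizer_quot_mul_card_le h.swap₁₂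
  set a := (T.filter (· ∈ Subgroup.normalizer {g : G | ∃ x ∈ S, ∃ x' ∈ S, x * x'⁻¹ = g})).card
  set b := (U.filter (· ∈ Subgroup.normalizer {g : G | ∃ x ∈ T, ∃ x' ∈ T, x * x'⁻¹ = g})).card
  set c := (S.filter (· ∈ Subgroup.normalizer {g : G | ∃ x ∈ U, ∃ x' ∈ U, x * x'⁻¹ = g})).card
  calc (S.card * T.card * U.card) ^ 2 * (a * b * c)
      = (U.card * a * S.card) * (S.card * b * T.card) * (T.card * c * U.card) := by ring
    _ ≤ Fintype.card G * Fintype.card G * Fintype.card G :=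
        Nat.mul_le_mul (Nat.mul_le_mul e1 e2) e3
    _ = Fintype.card G ^ 3 := by ring

/-- **BCGPU 2023, Remark 3.7, as printed**:
`|S| |T| |U| ≤ (|G|³ / (|N(Q(S)) ∩ T| |N(Q(T)) ∩ U| |N(Q(U)) ∩ S|))^{1/2}` for a TPP triple of subsets
of a finite group, when the three intersections are non-empty (otherwise the printed bound is vacuous
and `BCGPU2023_rem37_sq` is the content). [cite: BlasiakCohnGrochowPrattUmans2023, Rem. 3.7] -/
theorem BCGPU2023_rem37 [Fintype G] [DecidableEq G] {S T U : Finset G} (h : TripleProductProperty S T U)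
    [DecidablePred (· ∈ Subgroup.normalizer {g : G | ∃ x ∈ S, ∃ x' ∈ S, x * x'⁻¹ = g})]
    [DecidablePred (· ∈ Subgroup.normalizer {g : G | ∃ x ∈ T, ∃ x' ∈ T, x * x'⁻¹ = g})]
    [DecidablePred (· ∈ Subgroup.normalizer {g : G | ∃ x ∈ U, ∃ x' ∈ U, x * x'⁻¹ = g})]
    (ha : 0 < (T.filter (· ∈ Subgroup.normalizer {g : G | ∃ x ∈ S, ∃ x' ∈ S, x * x'⁻¹ = g})).card)
    (hb : 0 < (U.filter (· ∈ Subgroup.normalizer {g : G | ∃ x ∈ T, ∃ x' ∈ T, x * x'⁻¹ = g})).card)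
    (hc : 0 < (S.filter (· ∈ Subgroup.normalizer {g : G | ∃ x ∈ U, ∃ x' ∈ U, x * x'⁻¹ = g})).card) :
    ((S.card * T.card * U.card : ℕ) : ℝ) ≤
      Real.sqrt ((Fintype.card G : ℝ) ^ 3 /
        (((T.filter (· ∈ Subgroup.normalizer {g : G | ∃ x ∈ S, ∃ x' ∈ S, x * x'⁻¹ = g})).card : ℝ) *
          ((U.filter (· ∈ Subgroup.normalizer {g : G | ∃ x ∈ T, ∃ x' ∈ T, x * x'⁻¹ = g})).card : ℝ) *
          ((S.filter (· ∈ Subgroup.normalizer {g : G | ∃ x ∈ U, ∃ x' ∈ U, x * x'⁻¹ = g})).card : ℝ))) := by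
  have hsq := BCGPU2023_rem37_sq h
  set P : ℕ := S.card * T.card * U.card with hP
  set a := (T.filter (· ∈ Subgroup.normalizer {g : G | ∃ x ∈ S, ∃ x' ∈ S, x * x'⁻¹ = g})).card
  set b := (U.filter (· ∈ Subgroup.normalizer {g : G | ∃ x ∈ T, ∃ x' ∈ T, x * x'⁻¹ = g})).card
  set c := (S.filter (· ∈ Subgroup.normalizer {g : G | ∃ x ∈ U, ∃ x' ∈ U, x * x'⁻¹ = g})).card
  have habc : (0 : ℝ) < (a : ℝ) * (b : ℝ) * (c : ℝ) := by positivity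
  apply Real.le_sqrt_of_sq_le
  rw [le_div_iff₀ habc]
  have : ((P : ℕ) : ℝ) ^ 2 * ((a : ℝ) * (b : ℝ) * (c : ℝ)) = ((P ^ 2 * (a * b * c) : ℕ) : ℝ) := by
    push_cast; ring
  rw [this]
  exact_mod_cast hsq

end Literature.Barriers.MatrixMultiplication
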